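import Mathlib
import Summits.MatrixMultiplication.MatrixMultiplication.Theorems.SubgroupIdentityDesigns.Negative.BorelLevelOne
import Summits.MatrixMultiplication.MatrixMultiplication.Theorems.SubgroupIdentityDesigns.Negative.LevelOneSpan

/-!
# Reversal symmetry of level-one identity designs on `GL₂(𝔽_p)`
(negative-side lemma for the crux `SubgroupIdentityDesigns`, stmt-MatrixMultiplication-14079; cell B2b-5, gen 8)

The identity-design clause of the crux at `(m,k) = (2,1)` asks, for subgroups `H₁, H₂, H₃ ≤ GL₂(𝔽_p)`, for a
level-one function `f = Σ_{rk M ≤ 1} c_M ψ(tr(M·))` with `f(1) = 1` and `f(abg) = 0` for `a ∈ H₁, b ∈ H₂, g ∈ H₃`,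
`abg ≠ 1`.  The exact census of the cell `(2,1,11)` (reports `run/shared/lean/b2b/levelgraded-cu/ORACLE-g7.md`,
`ORACLE-g8.md`) enumerates triples only up to the REVERSAL `(H₁,H₂,H₃) ↦ (H₃,H₂,H₁)` (engine `g7.c`, mode
`g7enum`: "class(H₃) ≥ class(H₁)"; 173 331 of the 273 888 disjoint pairs are skipped by it).  This file makes that
reduction a theorem:

* `mulVec_inv_eq_iff` — `[g⁻¹ a = w] ↔ [g w = a]`: inversion permutes the fibre indicators.
* `fibreIndicator_mem_levelSet` — every fibre indicator `g ↦ [g w = a]` is a level-one function (frame duality,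
  `frameIndicator_mem_levelSet` with `2 × 1` frames).
* `comp_inv_mem_levelSet` — `F_1 ∘ inv = F_1`: if `f` is level one then so is `g ↦ f(g⁻¹)` (level-one functions
  are combinations of fibre indicators, `LevelOneSpan.fourierMat_mem_span_fibre`).
* `design_reverse` — THE REDUCTION: a level-one identity design for `(H₁,H₂,H₃)` yields one for `(H₃,H₂,H₁)`
  (`f ↦ f ∘ inv`, using `(gba)⁻¹ = a⁻¹b⁻¹g⁻¹`); `design_reverse_iff` — the two clauses are equivalent.
Sorry-free; standard axioms.  VALUE = a theorem making a census reduction kernel-sound, NOT summit progress; the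
crux item stays open.
-/

set_option linter.dupNamespace false

noncomputable section

open scoped BigOperators Classical
open Summit.MatrixMultiplication.MatrixMultiplication.Theorems.LieRankDesigns.Negative
  (GLm Mat fourierFn RankSupp levelSet)
open Summit.MatrixMultiplication.MatrixMultiplication.Theorems.LieRankDesigns.LevelOfFixedVector
  (zero_mem_levelSet add_mem_levelSet smul_mem_levelSet)

namespace Summit.MatrixMultiplication.MatrixMultiplication.Theorems.SubgroupIdentityDesigns.Negative

namespace Reversal

variable {p : ℕ} [Fact p.Prime]

/-- Inversion permutes fibres: `g⁻¹ a = w ↔ g w = a`. -/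
theorem mulVec_inv_eq_iff (a w : Fin 2 → ZMod p) (g : GLm p 2) :
    ((g⁻¹ : GLm p 2) : Mat p 2).mulVec a = w ↔ (g : Mat p 2).mulVec w = a := by
  constructor
  · intro h
    rw [← h, Matrix.mulVec_mulVec, ← Units.val_mul, mul_inv_cancel, Units.val_one, Matrix.one_mulVec]
  · intro h
    rw [← h, Matrix.mulVec_mulVec, ← Units.val_mul, inv_mul_cancel, Units.val_one, Matrix.one_mulVec]

/-- A `2 × 1` frame equation is a fibre equation: `s · col(w) = col(a) ↔ s w = a`. -/
theorem mul_colOf_eq_iff (s : Mat p 2) (w a : Fin 2 → ZMod p) :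
    s * Matrix.of (fun i (_ : Fin 1) => w i) = Matrix.of (fun i (_ : Fin 1) => a i) ↔ s.mulVec w = a := by
  constructor
  · intro h
    funext i
    have hi := congrFun (congrFun h i) 0
    simpa [Matrix.mul_apply, Matrix.mulVec, dotProduct] using hi
  · intro h
    ext i j
    have hi := congrFun h i
    simp only [Matrix.mulVec, dotProduct] at hi
    simpa [Matrix.mul_apply] using hi

/-- Every fibre indicator `g ↦ [g w = a]` is a level-one function on `GL₂(𝔽_p)`. -/
theorem fibreIndicator_mem_levelSet (w a : Fin 2 → ZMod p) :
    (fun g : GLm p 2 => if (g : Mat p 2).mulVec w = a then (1 : ℂ) else 0) ∈ levelSet p 2 1 := by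
  have h := frameIndicator_mem_levelSet (p := p) (Matrix.of fun i (_ : Fin 1) => w i)
    (Matrix.of fun i (_ : Fin 1) => a i)
  simp only [mul_colOf_eq_iff] at h
  exact h

/-- **`F_1` IS CLOSED UNDER INVERSION.**  If `f` is a level-one function on `GL₂(𝔽_p)` then so is `g ↦ f(g⁻¹)`. -/
theorem comp_inv_mem_levelSet {f : GLm p 2 → ℂ} (hf : f ∈ levelSet p 2 1) :
    (fun g : GLm p 2 => f g⁻¹) ∈ levelSet p 2 1 := by
  obtain ⟨c, hc, hcf⟩ := hf
  have hspan := LevelOneSpan.fourierMat_mem_span_fibre (p := p) c hc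
  have key : ∀ F ∈ Submodule.span ℂ (Set.range fun aw : (Fin 2 → ZMod p) × (Fin 2 → ZMod p) =>
      fun s : CMat p 2 => if s.mulVec aw.1 = aw.2 then (1 : ℂ) else 0),
      (fun g : GLm p 2 => F ((g⁻¹ : GLm p 2) : Mat p 2)) ∈ levelSet p 2 1 := by
    intro F hF
    induction hF using Submodule.span_induction with
    | mem x hx =>
      obtain ⟨⟨a, w⟩, rfl⟩ := hx
      have he : (fun g : GLm p 2 => (fun s : CMat p 2 => if s.mulVec a = w then (1 : ℂ) else 0)
          ((g⁻¹ : GLm p 2) : Mat p 2)) =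
          fun g : GLm p 2 => if (g : Mat p 2).mulVec w = a then (1 : ℂ) else 0 := by
        funext g
        simp only [mulVec_inv_eq_iff]
      rw [he]
      exact fibreIndicator_mem_levelSet w a
    | zero => exact zero_mem_levelSet 1
    | add x y _ _ hx hy => exact add_mem_levelSet hx hy
    | smul r x _ hx => exact smul_mem_levelSet hx r
  have hF := key _ hspan
  refine (show (fun g : GLm p 2 => f g⁻¹) = fun g : GLm p 2 => fourierMat c ((g⁻¹ : GLm p 2) : Mat p 2)
    from ?_) ▸ hF
  funext g
  rw [hcf]
  rfl

/-- **REVERSAL OF IDENTITY DESIGNS.**  A level-one identity design for `(H₁,H₂,H₃)` (the literal second clause of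
`SubgroupIdentityDesigns` at `m = 2`, `k = 1`) yields one for the reversed triple `(H₃,H₂,H₁)`. -/
theorem design_reverse (H₁ H₂ H₃ : Subgroup (GLm p 2))
    (h : ∃ c : Matrix (Fin 2) (Fin 2) (ZMod p) → ℂ, (∀ M, 1 < M.rank → c M = 0) ∧
      (∑ M, c M * ZMod.stdAddChar (Matrix.trace (M * ((1 : GLm p 2) : Mat p 2)))) = 1 ∧
      ∀ a ∈ H₁, ∀ b ∈ H₂, ∀ g ∈ H₃, a * b * g ≠ 1 →
        (∑ M, c M * ZMod.stdAddChar (Matrix.trace (M * ((a * b * g : GLm p 2) : Mat p 2)))) = 0) :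
    ∃ c : Matrix (Fin 2) (Fin 2) (ZMod p) → ℂ, (∀ M, 1 < M.rank → c M = 0) ∧
      (∑ M, c M * ZMod.stdAddChar (Matrix.trace (M * ((1 : GLm p 2) : Mat p 2)))) = 1 ∧
      ∀ g ∈ H₃, ∀ b ∈ H₂, ∀ a ∈ H₁, g * b * a ≠ 1 →
        (∑ M, c M * ZMod.stdAddChar (Matrix.trace (M * ((g * b * a : GLm p 2) : Mat p 2)))) = 0 := by
  obtain ⟨c, hc, h1, h0⟩ := h
  have hf : (fourierFn c : GLm p 2 → ℂ) ∈ levelSet p 2 1 := ⟨c, hc, fun _ => rfl⟩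
  obtain ⟨c', hc', hcf'⟩ := comp_inv_mem_levelSet hf
  refine ⟨c', hc', ?_, ?_⟩
  · have e := hcf' 1
    simp only [inv_one] at e
    change fourierFn c' 1 = 1
    rw [← e]
    exact h1
  · intro g hg b hb a ha hne
    have e := hcf' (g * b * a)
    change fourierFn c' (g * b * a) = 0
    rw [← e]
    have hinv : (g * b * a)⁻¹ = a⁻¹ * b⁻¹ * g⁻¹ := by
      rw [mul_inv_rev, mul_inv_rev, mul_assoc]
    have hne' : a⁻¹ * b⁻¹ * g⁻¹ ≠ 1 := by
      rw [← hinv]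
      exact fun h1' => hne (inv_eq_one.mp h1')
    show fourierFn c (g * b * a)⁻¹ = 0
    rw [hinv]
    exact h0 a⁻¹ (H₁.inv_mem ha) b⁻¹ (H₂.inv_mem hb) g⁻¹ (H₃.inv_mem hg) hne'

/-- The identity-design clauses of `(H₁,H₂,H₃)` and of the reversed triple `(H₃,H₂,H₁)` are EQUIVALENT — the
census may enumerate triples up to reversal. -/
theorem design_reverse_iff (H₁ H₂ H₃ : Subgroup (GLm p 2)) :
    (∃ c : Matrix (Fin 2) (Fin 2) (ZMod p) → ℂ, (∀ M, 1 < M.rank → c M = 0) ∧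
      (∑ M, c M * ZMod.stdAddChar (Matrix.trace (M * ((1 : GLm p 2) : Mat p 2)))) = 1 ∧
      ∀ a ∈ H₁, ∀ b ∈ H₂, ∀ g ∈ H₃, a * b * g ≠ 1 →
        (∑ M, c M * ZMod.stdAddChar (Matrix.trace (M * ((a * b * g : GLm p 2) : Mat p 2)))) = 0) ↔
    ∃ c : Matrix (Fin 2) (Fin 2) (ZMod p) → ℂ, (∀ M, 1 < M.rank → c M = 0) ∧
      (∑ M, c M * ZMod.stdAddChar (Matrix.trace (M * ((1 : GLm p 2) : Mat p 2)))) = 1 ∧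
      ∀ g ∈ H₃, ∀ b ∈ H₂, ∀ a ∈ H₁, g * b * a ≠ 1 →
        (∑ M, c M * ZMod.stdAddChar (Matrix.trace (M * ((g * b * a : GLm p 2) : Mat p 2)))) = 0 :=
  ⟨design_reverse H₁ H₂ H₃, design_reverse H₃ H₂ H₁⟩

end Reversal

end Summit.MatrixMultiplication.MatrixMultiplication.Theorems.SubgroupIdentityDesigns.Negative
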